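import Mathlib
import Summits.MatrixMultiplication.MatrixMultiplication.Theorems.LieRankDesigns.Negative.Basics

/-!
# Stub `stub_lowerPiece` (line `levi-free-rigid-outer-pieces`, crux `SubgroupIdentityDesigns`, stmt-MatrixMultiplication-14079)

Crux `Summit.MatrixMultiplication.MatrixMultiplication.Theses.LevelGradedCohnUmans.SubgroupIdentityDesigns`,
line `levi-free-rigid-outer-pieces`; this file proves the registered stub `stub_lowerPiece` verbatim (name +
signature) and lands `--supports stmt-MatrixMultiplication-14079`.

Content.  `G = GL_{k+r}(𝔽_p)` in block coordinates `Fin (k + r) = Fin.castAdd r (Fin k) ⊔ Fin.natAdd k (Fin r)`.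
For EVERY subgroup `T ≤ GL_r(𝔽_p)` the LOWER RIGID PIECE
`H = {[[u, 0], [X, t]] : u ∈ U_k⁻ (lower unitriangular), X ∈ M_{r × k}(𝔽_p), t ∈ T}`
is (the carrier of) a subgroup of `G` — the predicate holds at `1` and is closed under products
(`[[u,0],[X,t]] · [[u',0],[X',t']] = [[uu', 0], [Xu' + tX', tt']]`), and in a finite group a product-closed subset
containing `1` is a subgroup (`exists_subgroup_iff`) — and ANY subgroup with this carrier has order
`p^{C(k,2) + rk} · |T|`: the map `(strictly-lower entries of u, X, t) ↦ [[u,0],[X,t]]` is a bijection from a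
product type of that cardinality onto `H` (invertibility: `det [[u,0],[X,t]] = det u · det t = det t`, by
`Matrix.det_fromBlocks_zero₁₂` and `Matrix.det_of_lowerTriangular`).  Pure bookkeeping over Mathlib; the only
project import is `LieRankDesigns.Negative.Basics`, for the abbreviations `GLm`, `Mat`.  (The folklore subgroup
criterion is re-derived here in iff-form, `exists_subgroup_iff`, rather than imported from the sibling stub files
`…Theorems.LevelGradedCohnUmansLieRankDesignsStub{ParabolicFacts,SharpLevelDegree}`, those modules not being
built on the farm when this file was checked.)
-/

set_option linter.dupNamespace false

noncomputable section

open scoped BigOperators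
open Summit.MatrixMultiplication.MatrixMultiplication.Theorems.LieRankDesigns.Negative (GLm Mat)

namespace Summit.MatrixMultiplication.MatrixMultiplication.Theorems.LeviFreeRigidOuterPieces

namespace LowerPiece

/-! ### Generalities -/

/-- A predicate on a finite group is the membership predicate of some subgroup iff it holds at `1` and is
closed under products (`a⁻¹ = a ^ (orderOf a - 1)`).  Iff-form of the tree's
`LieRankDesigns.ParabolicFacts.exists_subgroup_of_mul_mem`. [folklore] -/
theorem exists_subgroup_iff {G : Type*} [Group G] [Finite G] (S : G → Prop) :
    (∃ K : Subgroup G, ∀ g, g ∈ K ↔ S g) ↔ S 1 ∧ ∀ a b, S a → S b → S (a * b) := by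
  constructor
  · rintro ⟨K, hK⟩
    exact ⟨(hK 1).mp K.one_mem, fun a b ha hb => (hK _).mp (K.mul_mem ((hK a).mpr ha) ((hK b).mpr hb))⟩
  · rintro ⟨h1, hmul⟩
    let M : Submonoid G :=
      { carrier := {g | S g}, one_mem' := h1, mul_mem' := fun ha hb => hmul _ _ ha hb }
    refine ⟨{ M with inv_mem' := fun {a} ha => ?_ }, fun g => Iff.rfl⟩
    change a⁻¹ ∈ M
    rw [← one_mul a⁻¹, ← pow_one a, ← pow_orderOf_eq_one a, ← pow_sub a (orderOf_pos a)]
    exact M.pow_mem ha (orderOf a - 1)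

/-- The number of pairs `j < i` in `Fin k` is `C(k, 2)`. [folklore] -/
theorem card_strictLower (k : ℕ) : Nat.card {q : Fin k × Fin k // q.2 < q.1} = k.choose 2 := by
  classical
  rw [Nat.card_eq_fintype_card, Fintype.card_subtype, Finset.card_filter, Fintype.sum_prod_type]
  simp_rw [← Finset.card_filter, Finset.filter_gt_eq_Iio, Fin.card_Iio]
  rw [Fin.sum_univ_eq_sum_range (fun a => a) k, Finset.sum_range_id, Nat.choose_two_right]

/-! ### Entries of products of block matrices on `Fin (k + r)` -/

/-- `(x y)_{ab} = Σ_{l < k} x_{a l} y_{l b} + Σ_{l ≥ k} x_{a l} y_{l b}`. [folklore] -/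
theorem mul_apply_split {p k r : ℕ} (x y : Mat p (k + r)) (a b : Fin (k + r)) :
    (x * y) a b = ∑ l : Fin k, x a (Fin.castAdd r l) * y (Fin.castAdd r l) b +
      ∑ l : Fin r, x a (Fin.natAdd k l) * y (Fin.natAdd k l) b := by
  rw [Matrix.mul_apply, Fin.sum_univ_add]

/-- Top-right blocks: a product of two matrices with vanishing top-right `k × r` block has vanishing
top-right block. [folklore] -/
theorem mul_topRight {p k r : ℕ} {x y : Mat p (k + r)}
    (hx : ∀ (i : Fin k) (j : Fin r), x (Fin.castAdd r i) (Fin.natAdd k j) = 0)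
    (hy : ∀ (i : Fin k) (j : Fin r), y (Fin.castAdd r i) (Fin.natAdd k j) = 0) (i : Fin k) (j : Fin r) :
    (x * y) (Fin.castAdd r i) (Fin.natAdd k j) = 0 := by
  rw [mul_apply_split, Finset.sum_eq_zero fun l _ => by rw [hy, mul_zero],
    Finset.sum_eq_zero fun l _ => by rw [hx, zero_mul], add_zero]

/-- Diagonal of the top-left block: for two lower pieces `x`, `y` (top-right block `0`, top-left block
lower unitriangular) the top-left block of `x y` has diagonal `1`. [folklore] -/
theorem mul_diag {p k r : ℕ} {x y : Mat p (k + r)}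
    (hx : ∀ (i : Fin k) (j : Fin r), x (Fin.castAdd r i) (Fin.natAdd k j) = 0)
    (hx1 : ∀ i : Fin k, x (Fin.castAdd r i) (Fin.castAdd r i) = 1)
    (hx0 : ∀ i j : Fin k, i < j → x (Fin.castAdd r i) (Fin.castAdd r j) = 0)
    (hy1 : ∀ i : Fin k, y (Fin.castAdd r i) (Fin.castAdd r i) = 1)
    (hy0 : ∀ i j : Fin k, i < j → y (Fin.castAdd r i) (Fin.castAdd r j) = 0) (i : Fin k) :
    (x * y) (Fin.castAdd r i) (Fin.castAdd r i) = 1 := by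
  have h0 : ∑ l : Fin r, x (Fin.castAdd r i) (Fin.natAdd k l) * y (Fin.natAdd k l) (Fin.castAdd r i) = 0 :=
    Finset.sum_eq_zero fun l _ => by rw [hx, zero_mul]
  rw [mul_apply_split, h0, add_zero, Finset.sum_eq_single i, hx1, hy1, mul_one]
  · intro l _ hl
    rcases lt_or_gt_of_ne hl with h | h
    · rw [hy0 l i h, mul_zero]
    · rw [hx0 i l h, zero_mul]
  · exact fun h => absurd (Finset.mem_univ i) h

/-- Strictly upper part of the top-left block: for two lower pieces `x`, `y` the top-left block of `x y`
is again lower triangular. [folklore] -/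
theorem mul_upper {p k r : ℕ} {x y : Mat p (k + r)}
    (hx : ∀ (i : Fin k) (j : Fin r), x (Fin.castAdd r i) (Fin.natAdd k j) = 0)
    (hx0 : ∀ i j : Fin k, i < j → x (Fin.castAdd r i) (Fin.castAdd r j) = 0)
    (hy0 : ∀ i j : Fin k, i < j → y (Fin.castAdd r i) (Fin.castAdd r j) = 0) (i j : Fin k)
    (hij : i < j) : (x * y) (Fin.castAdd r i) (Fin.castAdd r j) = 0 := by
  have h0 : ∑ l : Fin r, x (Fin.castAdd r i) (Fin.natAdd k l) * y (Fin.natAdd k l) (Fin.castAdd r j) = 0 :=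
    Finset.sum_eq_zero fun l _ => by rw [hx, zero_mul]
  rw [mul_apply_split, h0, add_zero]
  refine Finset.sum_eq_zero fun l _ => ?_
  by_cases h : i < l
  · rw [hx0 i l h, zero_mul]
  · rw [hy0 l j (lt_of_le_of_lt (not_lt.mp h) hij), mul_zero]

/-- Bottom-right blocks multiply: if the top-right block of `y` vanishes and the bottom-right blocks of
`x`, `y` are `s`, `t`, then the bottom-right block of `x y` is `s t`. [folklore] -/
theorem mul_bottomRight {p k r : ℕ} {x y : Mat p (k + r)} {s t : Mat p r}
    (hy : ∀ (i : Fin k) (j : Fin r), y (Fin.castAdd r i) (Fin.natAdd k j) = 0)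
    (hxs : ∀ i j : Fin r, x (Fin.natAdd k i) (Fin.natAdd k j) = s i j)
    (hyt : ∀ i j : Fin r, y (Fin.natAdd k i) (Fin.natAdd k j) = t i j) (i j : Fin r) :
    (x * y) (Fin.natAdd k i) (Fin.natAdd k j) = (s * t) i j := by
  rw [mul_apply_split, Finset.sum_eq_zero fun l _ => by rw [hy, mul_zero], zero_add, Matrix.mul_apply]
  exact Finset.sum_congr rfl fun l _ => by rw [hxs, hyt]

/-! ### The lower piece is a subgroup -/

/-- **The lower rigid piece is a subgroup of `GL_{k+r}(𝔽_p)`**, for every `T ≤ GL_r(𝔽_p)`: the membership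
predicate (top-right block `0`, top-left block lower unitriangular, bottom-right block in `T`) holds at `1`
and is closed under products, and `GL_{k+r}(𝔽_p)` is finite (`exists_subgroup_iff`). [folklore] -/
theorem exists_lower (p k r : ℕ) [Fact p.Prime] (T : Subgroup (GLm p r)) :
    ∃ H : Subgroup (GLm p (k + r)), ∀ g : GLm p (k + r), g ∈ H ↔
      ((∀ (i : Fin (k)) (j : Fin (r)), (g : Mat p (k + r)) (Fin.castAdd (r) i) (Fin.natAdd (k) j) = 0) ∧
        (∀ i : Fin (k), (g : Mat p (k + r)) (Fin.castAdd (r) i) (Fin.castAdd (r) i) = 1) ∧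
        (∀ i j : Fin (k), i < j → (g : Mat p (k + r)) (Fin.castAdd (r) i) (Fin.castAdd (r) j) = 0) ∧
        (∃ t ∈ T, ∀ i j : Fin (r),
          (g : Mat p (k + r)) (Fin.natAdd (k) i) (Fin.natAdd (k) j) = (t : Mat p (r)) i j)) := by
  refine (exists_subgroup_iff _).mpr ⟨?_, ?_⟩
  · refine ⟨fun i j => ?_, fun i => ?_, fun i j hij => ?_, 1, T.one_mem, fun i j => ?_⟩
    · rw [Units.val_one]
      refine Matrix.one_apply_ne fun h => ?_
      have h' := congrArg Fin.val h
      simp only [Fin.val_castAdd, Fin.val_natAdd] at h'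
      have := i.isLt
      omega
    · rw [Units.val_one, Matrix.one_apply_eq]
    · rw [Units.val_one]
      exact Matrix.one_apply_ne fun h => hij.ne (Fin.castAdd_inj.mp h)
    · simp only [Units.val_one]
      by_cases h : i = j
      · subst h
        rw [Matrix.one_apply_eq, Matrix.one_apply_eq]
      · rw [Matrix.one_apply_ne fun h' => h ((Fin.natAdd_inj k).mp h'), Matrix.one_apply_ne h]
  · rintro x y ⟨hx, hx1, hx0, s, hs, hxs⟩ ⟨hy, hy1, hy0, t, ht, hyt⟩
    refine ⟨fun i j => ?_, fun i => ?_, fun i j hij => ?_, s * t, T.mul_mem hs ht, fun i j => ?_⟩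
    · rw [Units.val_mul]
      exact mul_topRight hx hy i j
    · rw [Units.val_mul]
      exact mul_diag hx hx1 hx0 hy1 hy0 i
    · rw [Units.val_mul]
      exact mul_upper hx hx0 hy0 i j hij
    · rw [Units.val_mul, Units.val_mul]
      exact mul_bottomRight hy hxs hyt i j

/-! ### Block matrices `[[U, 0], [X, t]]` on `Fin (k + r)` and the order of the lower piece -/

/-- Top-left entries of the reindexed block matrix. [folklore] -/
theorem block_apply₁₁ {R : Type*} {k r : ℕ} (A : Matrix (Fin k) (Fin k) R) (B : Matrix (Fin k) (Fin r) R)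
    (C : Matrix (Fin r) (Fin k) R) (D : Matrix (Fin r) (Fin r) R) (i j : Fin k) :
    Matrix.reindex finSumFinEquiv finSumFinEquiv (Matrix.fromBlocks A B C D)
      (Fin.castAdd r i) (Fin.castAdd r j) = A i j := by
  simp

/-- Top-right entries of the reindexed block matrix. [folklore] -/
theorem block_apply₁₂ {R : Type*} {k r : ℕ} (A : Matrix (Fin k) (Fin k) R) (B : Matrix (Fin k) (Fin r) R)
    (C : Matrix (Fin r) (Fin k) R) (D : Matrix (Fin r) (Fin r) R) (i : Fin k) (j : Fin r) :
    Matrix.reindex finSumFinEquiv finSumFinEquiv (Matrix.fromBlocks A B C D)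
      (Fin.castAdd r i) (Fin.natAdd k j) = B i j := by
  simp

/-- Bottom-left entries of the reindexed block matrix. [folklore] -/
theorem block_apply₂₁ {R : Type*} {k r : ℕ} (A : Matrix (Fin k) (Fin k) R) (B : Matrix (Fin k) (Fin r) R)
    (C : Matrix (Fin r) (Fin k) R) (D : Matrix (Fin r) (Fin r) R) (i : Fin r) (j : Fin k) :
    Matrix.reindex finSumFinEquiv finSumFinEquiv (Matrix.fromBlocks A B C D)
      (Fin.natAdd k i) (Fin.castAdd r j) = C i j := by
  simp

/-- Bottom-right entries of the reindexed block matrix. [folklore] -/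
theorem block_apply₂₂ {R : Type*} {k r : ℕ} (A : Matrix (Fin k) (Fin k) R) (B : Matrix (Fin k) (Fin r) R)
    (C : Matrix (Fin r) (Fin k) R) (D : Matrix (Fin r) (Fin r) R) (i j : Fin r) :
    Matrix.reindex finSumFinEquiv finSumFinEquiv (Matrix.fromBlocks A B C D)
      (Fin.natAdd k i) (Fin.natAdd k j) = D i j := by
  simp

/-- `det [[U, 0], [X, t]] = det t` for `U` lower unitriangular. [folklore] -/
theorem det_block {R : Type*} [CommRing R] {k r : ℕ} (U : Matrix (Fin k) (Fin k) R)
    (hU1 : ∀ i, U i i = 1) (hU0 : ∀ i j, i < j → U i j = 0) (X : Matrix (Fin r) (Fin k) R)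
    (t : Matrix (Fin r) (Fin r) R) :
    (Matrix.reindex finSumFinEquiv finSumFinEquiv (Matrix.fromBlocks U 0 X t)).det = t.det := by
  rw [Matrix.det_reindex_self, Matrix.det_fromBlocks_zero₁₂,
    Matrix.det_of_lowerTriangular U fun i j hij => hU0 i j (OrderDual.toDual_lt_toDual.mp hij),
    Finset.prod_eq_one fun i _ => hU1 i, one_mul]

/-- `[[U, 0], [X, t]]` is invertible for `U` lower unitriangular and `t` invertible. [folklore] -/
theorem isUnit_block {R : Type*} [CommRing R] {k r : ℕ} (U : Matrix (Fin k) (Fin k) R)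
    (hU1 : ∀ i, U i i = 1) (hU0 : ∀ i j, i < j → U i j = 0) (X : Matrix (Fin r) (Fin k) R)
    (t : Matrix (Fin r) (Fin r) R) (ht : IsUnit t) :
    IsUnit (Matrix.reindex finSumFinEquiv finSumFinEquiv (Matrix.fromBlocks U 0 X t)) := by
  rw [Matrix.isUnit_iff_isUnit_det, det_block U hU1 hU0, ← Matrix.isUnit_iff_isUnit_det]
  exact ht

/-- **Order of the lower rigid piece.**  Any subgroup `H ≤ GL_{k+r}(𝔽_p)` whose carrier is the lower piece
over `T` has `|H| = p^{C(k,2) + rk} · |T|`: `(a, X, t) ↦ [[u(a), 0], [X, t]]`, `u(a)` the lower unitriangular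
matrix with strictly-lower entries `a`, is a bijection
`(pairs j < i → 𝔽_p) × M_{r×k}(𝔽_p) × T → H`. [folklore] -/
theorem card_lower (p k r : ℕ) (T : Subgroup (GLm p r)) (H : Subgroup (GLm p (k + r)))
    (hH : ∀ g : GLm p (k + r), g ∈ H ↔
      ((∀ (i : Fin (k)) (j : Fin (r)), (g : Mat p (k + r)) (Fin.castAdd (r) i) (Fin.natAdd (k) j) = 0) ∧
        (∀ i : Fin (k), (g : Mat p (k + r)) (Fin.castAdd (r) i) (Fin.castAdd (r) i) = 1) ∧
        (∀ i j : Fin (k), i < j → (g : Mat p (k + r)) (Fin.castAdd (r) i) (Fin.castAdd (r) j) = 0) ∧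
        (∃ t ∈ T, ∀ i j : Fin (r),
          (g : Mat p (k + r)) (Fin.natAdd (k) i) (Fin.natAdd (k) j) = (t : Mat p (r)) i j))) :
    Nat.card H = p ^ (k.choose 2 + r * k) * Nat.card T := by
  classical
  -- the lower unitriangular block `U a` with strictly-lower entries `a`
  obtain ⟨U, hU⟩ : ∃ U : ({q : Fin k × Fin k // q.2 < q.1} → ZMod p) → Matrix (Fin k) (Fin k) (ZMod p),
      U = fun a => Matrix.of fun i j => if j = i then 1 else if h : j < i then a ⟨(i, j), h⟩ else 0 :=
    ⟨_, rfl⟩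
  have hUe : ∀ a i j, U a i j = if j = i then 1 else if h : j < i then a ⟨(i, j), h⟩ else 0 :=
    fun a i j => by simp only [hU, Matrix.of_apply]
  have hU1 : ∀ a i, U a i i = 1 := fun a i => by rw [hUe, if_pos rfl]
  have hU0 : ∀ a i j, i < j → U a i j = 0 := fun a i j hij => by
    rw [hUe, if_neg hij.ne', dif_neg (lt_asymm hij)]
  have hUa : ∀ a i j (h : j < i), U a i j = a ⟨(i, j), h⟩ := fun a i j h => by
    rw [hUe, if_neg h.ne, dif_pos h]
  -- the block matrix `B a X t = [[U a, 0], [X, t]]`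
  obtain ⟨B, hB⟩ : ∃ B : ({q : Fin k × Fin k // q.2 < q.1} → ZMod p) → (Fin r → Fin k → ZMod p) →
      Mat p r → Mat p (k + r), B = fun a X t =>
        Matrix.reindex finSumFinEquiv finSumFinEquiv (Matrix.fromBlocks (U a) 0 (Matrix.of X) t) :=
    ⟨_, rfl⟩
  have hB11 : ∀ a X t i j, B a X t (Fin.castAdd r i) (Fin.castAdd r j) = U a i j :=
    fun a X t i j => by simp only [hB, block_apply₁₁]
  have hB12 : ∀ a X t i j, B a X t (Fin.castAdd r i) (Fin.natAdd k j) = 0 :=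
    fun a X t i j => by simp only [hB, block_apply₁₂, Matrix.zero_apply]
  have hB21 : ∀ a X t i j, B a X t (Fin.natAdd k i) (Fin.castAdd r j) = X i j :=
    fun a X t i j => by simp only [hB, block_apply₂₁, Matrix.of_apply]
  have hB22 : ∀ a X t i j, B a X t (Fin.natAdd k i) (Fin.natAdd k j) = t i j :=
    fun a X t i j => by simp only [hB, block_apply₂₂]
  have hBu : ∀ a X (t : T), IsUnit (B a X ((t : GLm p r) : Mat p r)) := fun a X t => by
    simp only [hB]
    exact isUnit_block (U a) (hU1 a) (hU0 a) (Matrix.of X) _ (Units.isUnit (t : GLm p r))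
  have hmem : ∀ a X (t : T), (hBu a X t).unit ∈ H := fun a X t => by
    rw [hH, IsUnit.unit_spec]
    exact ⟨fun i j => hB12 .., fun i => by rw [hB11, hU1], fun i j hij => by rw [hB11, hU0 a i j hij],
      (t : GLm p r), t.2, fun i j => hB22 ..⟩
  -- the parametrisation `(a, X, t) ↦ B a X t` is a bijection onto `H`
  have hbij : Function.Bijective fun q : ({q : Fin k × Fin k // q.2 < q.1} → ZMod p) ×
      (Fin r → Fin k → ZMod p) × T => (⟨(hBu q.1 q.2.1 q.2.2).unit, hmem q.1 q.2.1 q.2.2⟩ : H) := by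
    constructor
    · rintro ⟨a, X, t⟩ ⟨a', X', t'⟩ h
      have hmat : B a X ((t : GLm p r) : Mat p r) = B a' X' ((t' : GLm p r) : Mat p r) := by
        have h' := congrArg (fun g : H => ((g : GLm p (k + r)) : Mat p (k + r))) h
        simpa only [IsUnit.unit_spec] using h'
      have ha : a = a' := by
        funext q
        obtain ⟨⟨i, j⟩, hq⟩ := q
        have h' := congrFun (congrFun hmat (Fin.castAdd r i)) (Fin.castAdd r j)
        rwa [hB11, hB11, hUa a i j hq, hUa a' i j hq] at h'
      have hX : X = X' := by
        funext i j
        have h' := congrFun (congrFun hmat (Fin.natAdd k i)) (Fin.castAdd r j)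
        rwa [hB21, hB21] at h'
      have ht : t = t' := by
        refine Subtype.ext (Units.ext (Matrix.ext fun i j => ?_))
        have h' := congrFun (congrFun hmat (Fin.natAdd k i)) (Fin.natAdd k j)
        rwa [hB22, hB22] at h'
      rw [ha, hX, ht]
    · rintro ⟨g, hg⟩
      obtain ⟨h1, h2, h3, t, ht, h4⟩ := (hH g).mp hg
      refine ⟨(fun q => (g : Mat p (k + r)) (Fin.castAdd r q.1.1) (Fin.castAdd r q.1.2),
        fun i j => (g : Mat p (k + r)) (Fin.natAdd k i) (Fin.castAdd r j), ⟨t, ht⟩), ?_⟩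
      refine Subtype.ext (Units.ext ?_)
      simp only [IsUnit.unit_spec]
      ext x y
      induction x using Fin.addCases with
      | left i =>
        induction y using Fin.addCases with
        | left j =>
          rw [hB11]
          rcases lt_trichotomy i j with hij | rfl | hji
          · rw [hU0 _ i j hij, h3 i j hij]
          · rw [hU1, h2]
          · exact hUa _ i j hji
        | right j => rw [hB12, h1]
      | right i =>
        induction y using Fin.addCases with
        | left j => exact hB21 ..
        | right j => rw [hB22, h4]
  rw [← Nat.card_eq_of_bijective _ hbij]
  simp only [Nat.card_prod, Nat.card_fun, Nat.card_zmod, Nat.card_fin, card_strictLower]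
  ring

end LowerPiece

open LowerPiece in
/-- **Stub (M) `stub_lowerPiece` — the lower rigid piece is a subgroup of the stated order** (registered
signature).  For every prime `p`, all `k, r : ℕ` and every `T ≤ GL_r(𝔽_p)`: the block matrices
`g = [[u, 0], [X, t]] ∈ GL_{k+r}(𝔽_p)` with `u` lower unitriangular (`g_ii = 1`, `g_ij = 0` for `i < j`),
top-right `k × r` block `0`, bottom-left block free and bottom-right block some `t ∈ T` form a subgroup
(`LowerPiece.exists_lower`), and any subgroup with exactly this carrier has order `p^{C(k,2) + rk} · |T|`
(`LowerPiece.card_lower`). -/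
theorem stub_lowerPiece :
    ∀ (p k r : ℕ) [Fact p.Prime] (T : Subgroup (GLm p r)),
      (∃ H : Subgroup (GLm p (k + r)), ∀ g : GLm p (k + r), g ∈ H ↔
        ((∀ (i : Fin (k)) (j : Fin (r)), (g : Mat p (k + r)) (Fin.castAdd (r) i) (Fin.natAdd (k) j) = 0) ∧
          (∀ i : Fin (k), (g : Mat p (k + r)) (Fin.castAdd (r) i) (Fin.castAdd (r) i) = 1) ∧
          (∀ i j : Fin (k), i < j → (g : Mat p (k + r)) (Fin.castAdd (r) i) (Fin.castAdd (r) j) = 0) ∧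
          (∃ t ∈ T, ∀ i j : Fin (r), (g : Mat p (k + r)) (Fin.natAdd (k) i) (Fin.natAdd (k) j) = (t : Mat p (r)) i j))) ∧
      (∀ H : Subgroup (GLm p (k + r)), (∀ g : GLm p (k + r), g ∈ H ↔
        ((∀ (i : Fin (k)) (j : Fin (r)), (g : Mat p (k + r)) (Fin.castAdd (r) i) (Fin.natAdd (k) j) = 0) ∧
          (∀ i : Fin (k), (g : Mat p (k + r)) (Fin.castAdd (r) i) (Fin.castAdd (r) i) = 1) ∧
          (∀ i j : Fin (k), i < j → (g : Mat p (k + r)) (Fin.castAdd (r) i) (Fin.castAdd (r) j) = 0) ∧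
          (∃ t ∈ T, ∀ i j : Fin (r), (g : Mat p (k + r)) (Fin.natAdd (k) i) (Fin.natAdd (k) j) = (t : Mat p (r)) i j))) →
        Nat.card H = p ^ (k.choose 2 + r * k) * Nat.card T) := by
  intro p k r _ T
  exact ⟨exists_lower p k r T, fun H hH => card_lower p k r T H hH⟩

end Summit.MatrixMultiplication.MatrixMultiplication.Theorems.LeviFreeRigidOuterPieces

end
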